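import Mathlib

/-!
# AtomicCalibrationR (stmt-QuantumFields-28169), E2 `stub_offDiagonalWhitney` — derivative bounds for the pairwise cut-off factors
# (construction (T) of the E2 helper note, evidence #19 on 28169; prover w4 g22, free hands)

For a smooth step `ψ` (`= 0` on `(−∞,1]`, `= 1` on `[4,∞)`) the factor `z ↦ ψ(4^k ‖z_l − z_{l'}‖²)` of the dyadic pair cut-off
`pairCut n k` (`AtomicCalibrationRPairCutoff`) has `‖D^i‖ ≤ (8·N·C·2^k)^i` for `1 ≤ i ≤ N`, where `C = C(ψ, N)` bounds the first `N`
derivatives of `ψ`: near pairs (`‖z_l − z_{l'}‖ ≤ 2·2^{−k}`) by the Faà di Bruno bound `norm_iteratedFDeriv_comp_le` and the explicit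
derivatives of `x ↦ ‖x‖²`; far pairs are locally constant.  Generic in `ψ`; instantiate with `PairCutoff.stepψ`.

* `norm_iteratedFDeriv_one_norm_sq_le`, `norm_iteratedFDeriv_two_norm_sq_le`, `iteratedFDeriv_add_three_norm_sq` (‖x‖² on a real
  inner product space: `‖D¹‖ ≤ 2‖x‖`, `‖D²‖ ≤ 2`, `D^{≥3} = 0`);
* `norm_iteratedFDeriv_scaledNormSq_le` (`z ↦ a‖Lz‖²` through a continuous linear `L`);
* `exists_bound_iteratedFDeriv_step` (uniform bound `C ≥ 1` on `D^{≤N} ψ`);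
* `norm_iteratedFDeriv_pairFactor_le` — the factor bound, near and far pairs together; `abs_pairFactor_le_one`.

Mathlib only; no stub/crux/rung/summit is closed; nothing here touches Yang–Mills; the YM mass gap is NOT proved. [folklore]
-/

set_option autoImplicit false

noncomputable section

open scoped BigOperators ContDiff
open Set Filter

namespace Summit.QuantumFields.YangMills.Cruxes.AtomicCalibrationR.PairCutoffDeriv

/-! ## Derivatives of `‖x‖²` -/

section NormSq

variable {F : Type*} [NormedAddCommGroup F] [InnerProductSpace ℝ F]

/-- The derivative of `‖·‖²` is the continuous linear map `x ↦ 2⟪x, ·⟫` (real scalar form of `fderiv_norm_sq`). -/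
theorem fderiv_norm_sq_eq : fderiv ℝ (fun y : F => ‖y‖ ^ 2) = ⇑((2 : ℝ) • innerSL ℝ (E := F)) := by
  funext x
  rw [fderiv_norm_sq_apply, FunLike.coe_smul, Pi.smul_apply]
  simp [two_smul]

/-- `‖D¹ ‖·‖² (x)‖ ≤ 2‖x‖`. -/
theorem norm_iteratedFDeriv_one_norm_sq_le (x : F) :
    ‖iteratedFDeriv ℝ 1 (fun y : F => ‖y‖ ^ 2) x‖ ≤ 2 * ‖x‖ := by
  have h := norm_iteratedFDeriv_fderiv (𝕜 := ℝ) (f := fun y : F => ‖y‖ ^ 2) (x := x) (n := 0)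
  rw [Nat.zero_add] at h
  rw [← h, norm_iteratedFDeriv_zero, fderiv_norm_sq_eq, FunLike.coe_smul, Pi.smul_apply, norm_smul, innerSL_apply_norm,
    Real.norm_eq_abs, abs_two]

/-- `‖D² ‖·‖² (x)‖ ≤ 2`. -/
theorem norm_iteratedFDeriv_two_norm_sq_le (x : F) :
    ‖iteratedFDeriv ℝ 2 (fun y : F => ‖y‖ ^ 2) x‖ ≤ 2 := by
  have h := norm_iteratedFDeriv_fderiv (𝕜 := ℝ) (f := fun y : F => ‖y‖ ^ 2) (x := x) (n := 1)
  rw [show (1 : ℕ) + 1 = 2 from rfl] at h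
  rw [← h, fderiv_norm_sq_eq]
  have h' := norm_iteratedFDeriv_fderiv (𝕜 := ℝ) (f := ⇑((2 : ℝ) • innerSL ℝ (E := F))) (x := x) (n := 0)
  rw [Nat.zero_add] at h'
  rw [← h', norm_iteratedFDeriv_zero, ContinuousLinearMap.fderiv]
  refine ContinuousLinearMap.opNorm_le_bound _ (by norm_num) fun y => ?_
  rw [FunLike.coe_smul, Pi.smul_apply, norm_smul, innerSL_apply_norm, Real.norm_eq_abs, abs_two]

/-- `D^{i+3} ‖·‖² = 0`. -/
theorem iteratedFDeriv_add_three_norm_sq (i : ℕ) (x : F) :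
    iteratedFDeriv ℝ (i + 3) (fun y : F => ‖y‖ ^ 2) x = 0 := by
  have h : ‖iteratedFDeriv ℝ (i + 3) (fun y : F => ‖y‖ ^ 2) x‖ = 0 := by
    have h1 := norm_iteratedFDeriv_fderiv (𝕜 := ℝ) (f := fun y : F => ‖y‖ ^ 2) (x := x) (n := i + 2)
    rw [show i + 2 + 1 = i + 3 by ring] at h1
    rw [← h1, fderiv_norm_sq_eq]
    have h2 := norm_iteratedFDeriv_fderiv (𝕜 := ℝ) (f := ⇑((2 : ℝ) • innerSL ℝ (E := F))) (x := x) (n := i + 1)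
    rw [show i + 1 + 1 = i + 2 by ring] at h2
    rw [← h2]
    have hT : fderiv ℝ (⇑((2 : ℝ) • innerSL ℝ (E := F))) = fun _ => ((2 : ℝ) • innerSL ℝ (E := F)) := by
      funext y; exact ContinuousLinearMap.fderiv _
    rw [hT, iteratedFDeriv_const_of_ne (by omega), Pi.zero_apply, norm_zero]
  exact norm_eq_zero.1 h

/-- All orders at once: `‖D^j ‖·‖² (x)‖ ≤ b j` with `b 1 = 2‖x‖`, `b 2 = 2`, `b (j+3) = 0`. -/
theorem norm_iteratedFDeriv_norm_sq_le_of_pos {j : ℕ} (hj : 1 ≤ j) (x : F) :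
    ‖iteratedFDeriv ℝ j (fun y : F => ‖y‖ ^ 2) x‖ ≤ if j = 1 then 2 * ‖x‖ else if j = 2 then 2 else 0 := by
  rcases Nat.lt_or_ge j 3 with h | h
  · interval_cases j
    · simp only [if_true]; exact norm_iteratedFDeriv_one_norm_sq_le x
    · simp only [show (2 : ℕ) ≠ 1 by norm_num, if_false, if_true]; exact norm_iteratedFDeriv_two_norm_sq_le x
  · obtain ⟨i, rfl⟩ : ∃ i, j = i + 3 := ⟨j - 3, by omega⟩
    rw [iteratedFDeriv_add_three_norm_sq, norm_zero]
    simp only [show i + 3 ≠ 1 by omega, show i + 3 ≠ 2 by omega, if_false]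
    exact le_rfl

end NormSq

/-! ## `z ↦ a ‖L z‖²` -/

section Scaled

variable {E : Type*} [NormedAddCommGroup E] [NormedSpace ℝ E] {F : Type*} [NormedAddCommGroup F] [InnerProductSpace ℝ F]

/-- Chain rule bound for `z ↦ a‖Lz‖²`: `‖D^j‖ ≤ a · b_j(Lz) · ‖L‖^j` with `b` as in `norm_iteratedFDeriv_norm_sq_le_of_pos`. -/
theorem norm_iteratedFDeriv_scaledNormSq_le (L : E →L[ℝ] F) {a : ℝ} (ha : 0 ≤ a) {j : ℕ} (hj : 1 ≤ j) (z : E) :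
    ‖iteratedFDeriv ℝ j (fun z : E => a * ‖L z‖ ^ 2) z‖ ≤
      a * (if j = 1 then 2 * ‖L z‖ else if j = 2 then 2 else 0) * ‖L‖ ^ j := by
  have hq : ContDiff ℝ ∞ (fun y : F => ‖y‖ ^ 2) := contDiff_norm_sq ℝ
  have hqL : ContDiff ℝ ∞ ((fun y : F => ‖y‖ ^ 2) ∘ L) := hq.comp L.contDiff
  have hfun : (fun z : E => a * ‖L z‖ ^ 2) = a • ((fun y : F => ‖y‖ ^ 2) ∘ L) := by
    funext z; simp only [Pi.smul_apply, Function.comp_apply, smul_eq_mul]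
  rw [hfun, iteratedFDeriv_const_smul_apply (hqL.contDiffAt.of_le (by exact_mod_cast le_top)), norm_smul,
    Real.norm_eq_abs, abs_of_nonneg ha, mul_assoc]
  refine mul_le_mul_of_nonneg_left ?_ ha
  rw [L.iteratedFDeriv_comp_right hq z (by exact_mod_cast le_top)]
  have h1 := ContinuousMultilinearMap.norm_compContinuousLinearMap_le (iteratedFDeriv ℝ j (fun y : F => ‖y‖ ^ 2) (L z))
    (fun _ => L)
  simp only [Finset.prod_const, Finset.card_univ, Fintype.card_fin] at h1
  refine h1.trans (mul_le_mul_of_nonneg_right (norm_iteratedFDeriv_norm_sq_le_of_pos hj (L z)) (by positivity))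

end Scaled

/-! ## Uniform bounds on the derivatives of a smooth step -/

/-- The derivatives of a constant function have norm `≤ ‖c‖`. -/
theorem norm_iteratedFDeriv_const_le {E : Type*} [NormedAddCommGroup E] [NormedSpace ℝ E] (i : ℕ) (c : ℝ) (t : E) :
    ‖iteratedFDeriv ℝ i (fun _ : E => c) t‖ ≤ ‖c‖ := by
  rcases Nat.eq_zero_or_pos i with rfl | hi
  · rw [norm_iteratedFDeriv_zero]
  · rw [iteratedFDeriv_const_of_ne (Nat.pos_iff_ne_zero.1 hi), Pi.zero_apply, norm_zero]; exact norm_nonneg _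

/-- **Uniform derivative bound for a smooth step.**  If `ψ` is `C^∞`, `= 0` on `(−∞,1]` and `= 1` on `[4,∞)`, then for every `N`
there is `C ≥ 1` with `‖D^i ψ (t)‖ ≤ C` for all `i ≤ N` and all `t`. -/
theorem exists_bound_iteratedFDeriv_step {ψ : ℝ → ℝ} (hψ : ContDiff ℝ ∞ ψ) (h0 : ∀ x, x ≤ 1 → ψ x = 0)
    (h1 : ∀ x, 4 ≤ x → ψ x = 1) (N : ℕ) :
    ∃ C : ℝ, 1 ≤ C ∧ ∀ i : ℕ, i ≤ N → ∀ t : ℝ, ‖iteratedFDeriv ℝ i ψ t‖ ≤ C := by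
  -- on the compact interval `[0, 5]` each derivative is bounded by continuity
  have hB : ∀ i : ℕ, ∃ B : ℝ, 0 ≤ B ∧ ∀ t ∈ Icc (0 : ℝ) 5, ‖iteratedFDeriv ℝ i ψ t‖ ≤ B := by
    intro i
    have hcont : Continuous (iteratedFDeriv ℝ i ψ) := hψ.continuous_iteratedFDeriv (by exact_mod_cast le_top)
    obtain ⟨B, hB⟩ := isCompact_Icc.exists_bound_of_continuousOn hcont.continuousOn
    exact ⟨max B 0, le_max_right _ _, fun t ht => (hB t ht).trans (le_max_left _ _)⟩
  choose B hB0 hB using hB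
  refine ⟨1 + ∑ i ∈ Finset.range (N + 1), B i, by
    have := Finset.sum_nonneg fun i (_ : i ∈ Finset.range (N + 1)) => hB0 i; linarith, fun i hi t => ?_⟩
  have hBi : B i ≤ ∑ i ∈ Finset.range (N + 1), B i :=
    Finset.single_le_sum (fun j _ => hB0 j) (Finset.mem_range.2 (Nat.lt_succ_of_le hi))
  by_cases ht : t ∈ Icc (0 : ℝ) 5
  · exact (hB i t ht).trans (by linarith)
  · rw [mem_Icc, not_and_or, not_le, not_le] at ht
    rcases ht with ht | ht
    · -- `t < 0`: `ψ = 0` near `t`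
      have hev : ψ =ᶠ[nhds t] fun _ => (0 : ℝ) :=
        (eventually_lt_nhds ht).mono fun s hs => h0 s (by linarith)
      rw [(hev.iteratedFDeriv ℝ i).eq_of_nhds]
      exact (norm_iteratedFDeriv_const_le i 0 t).trans (by simp; linarith [Finset.sum_nonneg fun j (_ : j ∈ Finset.range (N + 1)) => hB0 j])
    · -- `t > 5`: `ψ = 1` near `t`
      have hev : ψ =ᶠ[nhds t] fun _ => (1 : ℝ) :=
        (eventually_gt_nhds ht).mono fun s hs => h1 s (by linarith)
      rw [(hev.iteratedFDeriv ℝ i).eq_of_nhds]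
      exact (norm_iteratedFDeriv_const_le i 1 t).trans (by simp; linarith [Finset.sum_nonneg fun j (_ : j ∈ Finset.range (N + 1)) => hB0 j])

/-! ## The pair factor `z ↦ ψ(4^k ‖z_l − z_{l'}‖²)` -/

section Factor

variable {n : ℕ}

/-- The slot-difference map `z ↦ z_l − z_{l'}` as a continuous linear map, of norm `≤ 2`. -/
def slotDiff (n : ℕ) (l l' : Fin n) : (Fin n → EuclideanSpace ℝ (Fin 4)) →L[ℝ] EuclideanSpace ℝ (Fin 4) :=
  (ContinuousLinearMap.proj l : (Fin n → EuclideanSpace ℝ (Fin 4)) →L[ℝ] EuclideanSpace ℝ (Fin 4)) -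
    (ContinuousLinearMap.proj l' : (Fin n → EuclideanSpace ℝ (Fin 4)) →L[ℝ] EuclideanSpace ℝ (Fin 4))

/-- `slotDiff` evaluates to the slot difference. -/
@[simp] theorem slotDiff_apply (l l' : Fin n) (z : Fin n → EuclideanSpace ℝ (Fin 4)) :
    slotDiff n l l' z = z l - z l' := by
  simp [slotDiff]

/-- `‖slotDiff‖ ≤ 2`. -/
theorem norm_slotDiff_le (l l' : Fin n) : ‖slotDiff n l l'‖ ≤ 2 := by
  refine ContinuousLinearMap.opNorm_le_bound _ (by norm_num) fun z => ?_
  rw [slotDiff_apply]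
  calc ‖z l - z l'‖ ≤ ‖z l‖ + ‖z l'‖ := norm_sub_le _ _
    _ ≤ ‖z‖ + ‖z‖ := add_le_add (norm_le_pi_norm z l) (norm_le_pi_norm z l')
    _ = 2 * ‖z‖ := by ring

/-- Near pairs: the inner function `z ↦ 4^k‖z_l − z_{l'}‖²` has `‖D^j‖ ≤ (8·2^k)^j` for `j ≥ 1` when `‖z_l − z_{l'}‖ ≤ 2·2^{−k}`. -/
theorem norm_iteratedFDeriv_inner_le (k : ℕ) (l l' : Fin n) {z : Fin n → EuclideanSpace ℝ (Fin 4)}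
    (hz : ‖z l - z l'‖ ≤ 2 * (2 : ℝ)⁻¹ ^ k) {j : ℕ} (hj : 1 ≤ j) :
    ‖iteratedFDeriv ℝ j (fun z : Fin n → EuclideanSpace ℝ (Fin 4) => (4 : ℝ) ^ k * ‖z l - z l'‖ ^ 2) z‖ ≤
      (8 * (2 : ℝ) ^ k) ^ j := by
  have h1 := norm_iteratedFDeriv_scaledNormSq_le (slotDiff n l l') (a := (4 : ℝ) ^ k) (by positivity) hj z
  simp only [slotDiff_apply] at h1
  refine h1.trans ?_
  have hL := norm_slotDiff_le l l'
  have h4 : (4 : ℝ) ^ k = (2 : ℝ) ^ k * (2 : ℝ) ^ k := by rw [← mul_pow]; norm_num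
  have h22 : (2 : ℝ) ^ k * (2 : ℝ)⁻¹ ^ k = 1 := by rw [← mul_pow]; norm_num
  have h2k : (1 : ℝ) ≤ 2 ^ k := one_le_pow₀ (by norm_num)
  by_cases hj1 : j = 1
  · subst hj1
    simp only [if_true, pow_one]
    calc (4 : ℝ) ^ k * (2 * ‖z l - z l'‖) * ‖slotDiff n l l'‖
        ≤ (4 : ℝ) ^ k * (2 * (2 * (2 : ℝ)⁻¹ ^ k)) * 2 := by
          refine mul_le_mul (mul_le_mul_of_nonneg_left (by linarith) (by positivity)) hL (norm_nonneg _) (by positivity)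
      _ = 8 * 2 ^ k := by rw [h4]; linear_combination (8 * 2 ^ k) * h22
  · by_cases hj2 : j = 2
    · subst hj2
      simp only [show (2 : ℕ) ≠ 1 by norm_num, if_false, if_true]
      calc (4 : ℝ) ^ k * 2 * ‖slotDiff n l l'‖ ^ 2 ≤ (4 : ℝ) ^ k * 2 * 2 ^ 2 :=
            mul_le_mul_of_nonneg_left (pow_le_pow_left₀ (norm_nonneg _) hL 2) (by positivity)
        _ ≤ (8 * (2 : ℝ) ^ k) ^ 2 := by rw [h4]; nlinarith [h2k]
    · simp only [hj1, hj2, if_false, mul_zero, zero_mul]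
      positivity

/-- **Derivative bound for a pair factor.**  Let `ψ` be `C^∞` with `ψ = 1` on `[4, ∞)` and `‖D^i ψ‖ ≤ C` (`i ≤ N`, `C ≥ 1`).
Then for `1 ≤ i ≤ N`: `‖D^i (z ↦ ψ(4^k‖z_l − z_{l'}‖²)) z‖ ≤ (8·N·C·2^k)^i` (near pairs by Faà di Bruno, far pairs are locally
constant). [folklore] -/
theorem norm_iteratedFDeriv_pairFactor_le {ψ : ℝ → ℝ} (hψ : ContDiff ℝ ∞ ψ) (h1 : ∀ x, 4 ≤ x → ψ x = 1) {N : ℕ} {C : ℝ}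
    (hC1 : 1 ≤ C) (hC : ∀ i : ℕ, i ≤ N → ∀ t : ℝ, ‖iteratedFDeriv ℝ i ψ t‖ ≤ C) (k : ℕ) (l l' : Fin n)
    {i : ℕ} (hi1 : 1 ≤ i) (hiN : i ≤ N) (z : Fin n → EuclideanSpace ℝ (Fin 4)) :
    ‖iteratedFDeriv ℝ i (fun z : Fin n → EuclideanSpace ℝ (Fin 4) => ψ ((4 : ℝ) ^ k * ‖z l - z l'‖ ^ 2)) z‖ ≤
      (8 * N * C * (2 : ℝ) ^ k) ^ i := by
  have hg : ContDiff ℝ ∞ (fun z : Fin n → EuclideanSpace ℝ (Fin 4) => (4 : ℝ) ^ k * ‖z l - z l'‖ ^ 2) := by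
    have : ContDiff ℝ ∞ (fun z : Fin n → EuclideanSpace ℝ (Fin 4) => z l - z l') :=
      (contDiff_apply ℝ (EuclideanSpace ℝ (Fin 4)) l).sub (contDiff_apply ℝ (EuclideanSpace ℝ (Fin 4)) l')
    exact contDiff_const.mul (this.norm_sq ℝ)
  have hfun : (fun z : Fin n → EuclideanSpace ℝ (Fin 4) => ψ ((4 : ℝ) ^ k * ‖z l - z l'‖ ^ 2)) =
      ψ ∘ (fun z : Fin n → EuclideanSpace ℝ (Fin 4) => (4 : ℝ) ^ k * ‖z l - z l'‖ ^ 2) := rfl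
  by_cases hnear : ‖z l - z l'‖ ≤ 2 * (2 : ℝ)⁻¹ ^ k
  · -- near pair: Faà di Bruno
    rw [hfun]
    have hcomp := norm_iteratedFDeriv_comp_le (𝕜 := ℝ) (N := (⊤ : ℕ∞)) hψ hg (n := i) (by exact_mod_cast le_top) z
      (C := C) (D := 8 * (2 : ℝ) ^ k) (fun j hj => hC j (hj.trans hiN) _)
      (fun j hj _ => norm_iteratedFDeriv_inner_le k l l' hnear hj)
    refine hcomp.trans ?_
    -- `i! · C · D^i ≤ (N C D)^i`
    have hfac : ((i.factorial : ℕ) : ℝ) ≤ (N : ℝ) ^ i := by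
      have := Nat.factorial_le_pow i
      calc ((i.factorial : ℕ) : ℝ) ≤ ((i ^ i : ℕ) : ℝ) := by exact_mod_cast this
        _ = (i : ℝ) ^ i := by push_cast; ring
        _ ≤ (N : ℝ) ^ i := pow_le_pow_left₀ (Nat.cast_nonneg _) (by exact_mod_cast hiN) i
    have hCi : C ≤ C ^ i := le_self_pow₀ hC1 (by omega)
    have hD0 : 0 ≤ (8 * (2 : ℝ) ^ k) ^ i := by positivity
    calc ((i.factorial : ℕ) : ℝ) * C * (8 * (2 : ℝ) ^ k) ^ i ≤ (N : ℝ) ^ i * C ^ i * (8 * (2 : ℝ) ^ k) ^ i := by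
          refine mul_le_mul (mul_le_mul hfac hCi (by linarith) (by positivity)) le_rfl hD0 (by positivity)
      _ = (8 * N * C * (2 : ℝ) ^ k) ^ i := by rw [← mul_pow, ← mul_pow]; ring
  · -- far pair: locally constant `1`
    rw [not_le] at hnear
    have hopen : IsOpen {w : Fin n → EuclideanSpace ℝ (Fin 4) | 2 * (2 : ℝ)⁻¹ ^ k < ‖w l - w l'‖} :=
      isOpen_lt continuous_const (by fun_prop)
    have hev : (fun z : Fin n → EuclideanSpace ℝ (Fin 4) => ψ ((4 : ℝ) ^ k * ‖z l - z l'‖ ^ 2)) =ᶠ[nhds z]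
        fun _ => (1 : ℝ) := by
      filter_upwards [hopen.mem_nhds hnear] with w hw
      refine h1 _ ?_
      have h0 : 0 ≤ 2 * (2 : ℝ)⁻¹ ^ k := by positivity
      have hsq : (2 * (2 : ℝ)⁻¹ ^ k) ^ 2 ≤ ‖w l - w l'‖ ^ 2 := pow_le_pow_left₀ h0 (le_of_lt hw) 2
      have hkey : (4 : ℝ) ^ k * (2 * (2 : ℝ)⁻¹ ^ k) ^ 2 = 4 := by
        rw [mul_pow, ← pow_mul, show (4 : ℝ) = 2 ^ 2 by norm_num, ← pow_mul, inv_pow, mul_comm 2 k]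
        field_simp
      calc (4 : ℝ) = (4 : ℝ) ^ k * (2 * (2 : ℝ)⁻¹ ^ k) ^ 2 := hkey.symm
        _ ≤ (4 : ℝ) ^ k * ‖w l - w l'‖ ^ 2 := mul_le_mul_of_nonneg_left hsq (by positivity)
    rw [(hev.iteratedFDeriv ℝ i).eq_of_nhds, iteratedFDeriv_const_of_ne (by omega), Pi.zero_apply, norm_zero]
    positivity

/-- Order zero: `|ψ(…)| ≤ 1` whenever `|ψ| ≤ 1`. -/
theorem abs_pairFactor_le_one {ψ : ℝ → ℝ} (hψ1 : ∀ x, |ψ x| ≤ 1) (k : ℕ) (l l' : Fin n)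
    (z : Fin n → EuclideanSpace ℝ (Fin 4)) :
    ‖iteratedFDeriv ℝ 0 (fun z : Fin n → EuclideanSpace ℝ (Fin 4) => ψ ((4 : ℝ) ^ k * ‖z l - z l'‖ ^ 2)) z‖ ≤ 1 := by
  rw [norm_iteratedFDeriv_zero, Real.norm_eq_abs]; exact hψ1 _

/-- **Geometric form** ready for `ProductBump.norm_iteratedFDeriv_prod_le_pow`: with `M := 8·N·C·2^k` (`≥ 1`),
`‖D^j factor‖ ≤ M^j` for all `j ≤ N` (order `0` from `|ψ| ≤ 1`). -/
theorem norm_iteratedFDeriv_pairFactor_le_pow {ψ : ℝ → ℝ} (hψ : ContDiff ℝ ∞ ψ) (h1 : ∀ x, 4 ≤ x → ψ x = 1)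
    (hψ1 : ∀ x, |ψ x| ≤ 1) {N : ℕ} {C : ℝ} (hC1 : 1 ≤ C) (hC : ∀ i : ℕ, i ≤ N → ∀ t : ℝ, ‖iteratedFDeriv ℝ i ψ t‖ ≤ C)
    (k : ℕ) (l l' : Fin n) {j : ℕ} (hjN : j ≤ N) (z : Fin n → EuclideanSpace ℝ (Fin 4)) :
    ‖iteratedFDeriv ℝ j (fun z : Fin n → EuclideanSpace ℝ (Fin 4) => ψ ((4 : ℝ) ^ k * ‖z l - z l'‖ ^ 2)) z‖ ≤
      (8 * N * C * (2 : ℝ) ^ k) ^ j := by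
  rcases Nat.eq_zero_or_pos j with rfl | hj
  · rw [pow_zero]; exact abs_pairFactor_le_one hψ1 k l l' z
  · exact norm_iteratedFDeriv_pairFactor_le hψ h1 hC1 hC k l l' hj hjN z

end Factor

end Summit.QuantumFields.YangMills.Cruxes.AtomicCalibrationR.PairCutoffDeriv

end
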